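/-
Copyright (c) 2026. All rights reserved.
Released under Apache 2.0 license as described in the file LICENSE.
Authors: abc-iut cell, F fact-proving wave seat abc-iut-f-073 (tranche 73, exact criterion for F-0319).
-/
import Literature.AnabelianGeometry.AbsoluteAnabelian.AbsTopIII.BiAnabelianIncompatibilityKernelNecessity
import Literature.AnabelianGeometry.AbsoluteAnabelian.AbsTopIII.BiAnabelianIncompatibilityKernelFamily
import Literature.AnabelianGeometry.AbsoluteAnabelian.AbsTopIII.BiAnabelianIncompatibilitySchema

/-!
# [AbsTopIII] Cor 3.7 (iv), first incompatibility, as typed — the EXACT CRITERION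
# `IncompatibleStmt 𝔖 ↔ ¬ LogCoreKernel 𝔖`

S. Mochizuki, *Topics in absolute anabelian geometry III* [MochizukiAbsTopIII2015] (kurims manuscript
`paper:url-5493eb38cbb7`; journal pagination not held), Cor 3.7 (iv) p. 88 ("The diagram of
categories `𝒟†_{≤2}` does not admit a structure of core on `𝒟†_{≤1}` which [...] is compatible with
[...] the observable `𝔖†_log` of (iii)"), proof "entirely similar" to Cor 3.6 (iv) p. 81.

PROOF-ONLY file assembling the two halves (abc-iut-f-073, FACT-LIST tranche 73): for EVERY abstract
input `𝔖 : BiAnabelianSetting X E N` (abc-iut-L4-t9),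

  `IncompatibleStmt 𝔖` (F-0319, as typed)  ↔  `¬ LogCoreKernel 𝔖` (F-0388: no natural
  `ζ : 𝟭_𝒳 ⥲ log` with `λ^×(ζ_A) ≫ ι_{log,A} = ι_{×,A}` for all `A`)

— `→`: `not_logCoreKernel_of_incompatibleStmt` (`…KernelFamily.lean`: from such a `ζ` the lax
shadow family `kerFamily ζ` on `𝒟†_{≤3}` IS a structure of core on `𝒟†_{≤1}` compatible with
`𝔖†_log`); `←`: `incompatibleStmt_of_not_logCoreKernel` (`…KernelNecessity.lean`: a compatible core
structure restricted along `δ_𝒳` IS such a `ζ`, by the equation "`ζ'₁ = ζ₂`" of the printed proof).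
Consequences recorded here: the schema row F-0319 is thereby located EXACTLY (its earlier kernel
verdict `incompatibleStmt_schema_verdict` — closure refuted, MLF instance proved — is the pair of
special cases "terminal carriers satisfy `LogCoreKernel`" / "the MLF model violates it", Lemma 3.4);
a consumer may bind `¬ LogCoreKernel` (a theorem at the MLF model,
`TFModel.modelSetting_not_logCoreKernel`) in place of F-0319.

HONEST FRAMING: statements about the cell's typing of refereed pre-IUT material over ABSTRACT data;
the printed Cor 3.7 (iv) concerns the MLF data, where both sides hold by Lemma 3.4; nothing here
bears on [IUTchIII] Cor. 3.12 or takes a side; typed ≠ proved.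
-/

set_option autoImplicit false

namespace Literature.AnabelianGeometry.AbsoluteAnabelian.AbsTopIII

open CategoryTheory

universe u

namespace BiAnabelianSetting

variable {X E N : Type u} [Category.{u} X] [Category.{u} E] [Category.{u} N]
  (𝔖 : BiAnabelianSetting X E N)

/-- **[AbsTopIII] Cor 3.7 (iv), first incompatibility, as typed — EXACT CRITERION** (every
bi-anabelian setting): `𝒟†_{≤2}` admits no structure of core on `𝒟†_{≤1}` compatible with `𝔖†_log`
(`IncompatibleStmt`, F-0319) if and only if there is NO natural isomorphism `ζ : 𝟭_𝒳 ⥲ log` with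
`λ^×(ζ_A) ≫ ι_{log,A} = ι_{×,A}` for all `A` (`¬ LogCoreKernel`, F-0388).
[cite: MochizukiAbsTopIII2015, Cor 3.7 (iv) p.88] -/
theorem incompatibleStmt_iff_not_logCoreKernel :
    Literature.AnabelianGeometry.AbsoluteAnabelian.AbsTopIII.BiAnabelianSetting.IncompatibleStmt 𝔖 ↔
      ¬ Literature.AnabelianGeometry.AbsoluteAnabelian.AbsTopIII.BiAnabelianSetting.LogCoreKernel 𝔖 :=
  ⟨𝔖.not_logCoreKernel_of_incompatibleStmt, 𝔖.incompatibleStmt_of_not_logCoreKernel⟩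

/-- The same criterion, negated: `𝒟†_{≤2}` DOES admit a structure of core on `𝒟†_{≤1}` compatible with
`𝔖†_log` (as typed) iff the kernel statement holds. [cite: MochizukiAbsTopIII2015, Cor 3.7 (iv) p.88] -/
theorem not_incompatibleStmt_iff_logCoreKernel :
    ¬ Literature.AnabelianGeometry.AbsoluteAnabelian.AbsTopIII.BiAnabelianSetting.IncompatibleStmt 𝔖 ↔
      Literature.AnabelianGeometry.AbsoluteAnabelian.AbsTopIII.BiAnabelianSetting.LogCoreKernel 𝔖 :=
  ⟨𝔖.logCoreKernel_of_not_incompatibleStmt, 𝔖.not_incompatibleStmt_of_logCoreKernel⟩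

/-- **F-0319, the schema row located exactly** (universal closure over all settings of the
criterion): for every setting, `IncompatibleStmt 𝔖 ↔ ¬ LogCoreKernel 𝔖`.  The earlier verdict
`incompatibleStmt_schema_verdict` (closure refuted at terminal carriers; instance proved at the MLF
model) is the pair of special cases. [cite: MochizukiAbsTopIII2015, Cor 3.7 (iv) p.88] -/
theorem incompatibleStmt_exact_criterion :
    ∀ (X E N : Type u) [Category.{u} X] [Category.{u} E] [Category.{u} N]
      (𝔖 : BiAnabelianSetting X E N),
      Literature.AnabelianGeometry.AbsoluteAnabelian.AbsTopIII.BiAnabelianSetting.IncompatibleStmt 𝔖 ↔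
        ¬ Literature.AnabelianGeometry.AbsoluteAnabelian.AbsTopIII.BiAnabelianSetting.LogCoreKernel 𝔖 :=
  fun _ _ _ _ _ _ 𝔖 => 𝔖.incompatibleStmt_iff_not_logCoreKernel

/-- The settings on TERMINAL carriers (the witnesses against the universal closure of F-0319,
`not_incompatibleStmt_of_terminal`) satisfy the kernel statement — read off the criterion.
[cite: MochizukiAbsTopIII2015, Cor 3.7 (iv) p.88] -/
theorem logCoreKernel_of_terminal
    (𝔖 : BiAnabelianSetting (Discrete PUnit.{u + 1}) (Discrete PUnit.{u + 1}) (Discrete PUnit.{u + 1})) :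
    Literature.AnabelianGeometry.AbsoluteAnabelian.AbsTopIII.BiAnabelianSetting.LogCoreKernel 𝔖 :=
  𝔖.logCoreKernel_of_not_incompatibleStmt (not_incompatibleStmt_of_terminal 𝔖)

end BiAnabelianSetting

end Literature.AnabelianGeometry.AbsoluteAnabelian.AbsTopIII
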